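import Mathlib
import HarnessLib
import Summits.SmoothPoincare4.Statement
import Literature.Geometry.Symplectic.SteinDomain
import Literature.Geometry.Symplectic.SteinBoundaryContact
import Literature.Geometry.Symplectic.PlanarContactBoundary
import Literature.AlgebraicTopology.SingularHomology.SingularChains

/-!
# SmoothPoincare4 / ConvexBisection — Etnyre-free sector glue for `AcyclicBisectionRigidity`

Settles item stmt-SmoothPoincare4-15087 (support `AcyclicRigidityBySectorsPA` of route ConvexBisection):

  `PlanarAcyclicBisectionRigidity → ContractibleTwistedDoubleStandard → ResidualAcyclicBisectionRigidity
    → AcyclicBisectionRigidity`,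

i.e. crux 2 of the route (a Hausdorff second-countable `C^∞` 4-manifold `M ≃ₕ S⁴` carrying a Stein
bisection along a common contact seam with rationally acyclic halves is diffeomorphic to `S⁴`)
follows from its three sectors: planar seam with rationally acyclic halves (crux 5
`PlanarAcyclicBisectionRigidity`, the Etnyre-free planar sector: acyclicity of the halves is carried
as a hypothesis rather than derived from planarity), both halves contractible (crux 4
`ContractibleTwistedDoubleStandard`, applied to `X := M`, which is compact as the union of the two
compact embedded images), and the residual sector (crux 6 `ResidualAcyclicBisectionRigidity`: seam
not planar and halves not both contractible).

The statement below is, token for token, `(body of PlanarAcyclicBisectionRigidity) → (body of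
ContractibleTwistedDoubleStandard) → (body of ResidualAcyclicBisectionRigidity) → (body of
AcyclicBisectionRigidity)` as printed in the route file
`Summits/SmoothPoincare4/SmoothPoincare4/Theses/ConvexBisection.lean` (rev 5), so that the gate can
link it there as
`theorem AcyclicRigidityBySectorsPA_holds : AcyclicRigidityBySectorsPA := _root_.<this theorem>`
(definitional unfolding of the five route definitions).

Design choice (as for the route's assembly `Theorems/ConvexBisectionAssemblyStructural.lean` and the
sister glue `Theorems/ConvexBisectionAcyclicRigidityBySectors.lean`, p87624): this module deliberately
does NOT import the route file `Summits.SmoothPoincare4.SmoothPoincare4.Theses.ConvexBisection` — the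
gate auto-imports the closing module into that Theses file, and a Theses import here would close an
import cycle.  Imports are the problem statement plus the Literature modules providing
`SteinStructure`, `contactPlane`, `PlanarContactBoundary` and `singularHomology`.

Proof: pure logic — fix `M`, `e : M ≃ₕ S⁴` and a rationally acyclic Stein bisection
`(W₁, W₂, J₁, J₂, e₁, e₂)` of `M` (acyclicity witness `hacyc`); case on `PlanarContactBoundary J₁`
(then the planar sector applies to the same witness with `hacyc` and the planarity appended), else
on `ContractibleSpace W₁ ∧ ContractibleSpace W₂` (then `M = e₁(W₁) ∪ e₂(W₂)` is compact,
`isCompact_range` twice, and the contractible sector applies with `X := M`), else the residual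
sector applies to the same witness with `hacyc` and the two negations appended.  It is the script of
p87624 with `hacyc` passed on to the planar sector.  No named facts, no classical axioms beyond
`by_cases`.
-/

open scoped Manifold ContDiff
open ContinuousMap

namespace Summit.SmoothPoincare4.SmoothPoincare4.Theorems

/-- Settles stmt-SmoothPoincare4-15087 (support `AcyclicRigidityBySectorsPA` of route
ConvexBisection, structural form): if (planar sector, Etnyre-free) every Hausdorff second-countable
smooth 4-manifold `M ≃ₕ S⁴` with a Stein bisection along a common contact seam whose halves are
rationally acyclic in positive degrees and whose `J₁`-induced boundary contact structure is planar
is diffeomorphic to `S⁴`, and (contractible sector) every compact such 4-manifold that is a Stein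
bisection along a common contact seam of two compact contractible Stein domains is diffeomorphic to
`S⁴`, and (residual sector) every `M ≃ₕ S⁴` with a rationally acyclic Stein bisection whose seam is
not planar and whose halves are not both contractible is diffeomorphic to `S⁴`, then every
`M ≃ₕ S⁴` with a rationally acyclic Stein bisection along a common contact seam is diffeomorphic to
`S⁴`.  Verbatim `PlanarAcyclicBisectionRigidity → ContractibleTwistedDoubleStandard →
ResidualAcyclicBisectionRigidity → AcyclicBisectionRigidity` with the four route definitions
unfolded; proof by case analysis on planarity of the seam and contractibility of the halves,
compactness of `M` coming from the two compact embedded images, the acyclicity hypothesis being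
passed on to the planar and residual sectors. [folklore] -/
theorem convexBisection_acyclicRigidityBySectorsPA :
    (∀ (M : Type) [TopologicalSpace M] [T2Space M] [SecondCountableTopology M] [ChartedSpace (EuclideanSpace ℝ (Fin 4)) M] [IsManifold (𝓡 4) ∞ M], M ≃ₕ Metric.sphere (0 : EuclideanSpace ℝ (Fin 5)) 1 → (∃ (W₁ : Type) (_ : TopologicalSpace W₁) (_ : ChartedSpace (EuclideanHalfSpace 4) W₁) (_ : IsManifold (𝓡∂ 4) ∞ W₁) (_ : CompactSpace W₁) (W₂ : Type) (_ : TopologicalSpace W₂) (_ : ChartedSpace (EuclideanHalfSpace 4) W₂) (_ : IsManifold (𝓡∂ 4) ∞ W₂) (_ : CompactSpace W₂) (J₁ : Literature.Geometry.Symplectic.SteinStructure W₁) (J₂ : Literature.Geometry.Symplectic.SteinStructure W₂) (e₁ : W₁ → M) (e₂ : W₂ → M), Manifold.IsSmoothEmbedding (𝓡∂ 4) (𝓡 4) ∞ e₁ ∧ Manifold.IsSmoothEmbedding (𝓡∂ 4) (𝓡 4) ∞ e₂ ∧ Set.range e₁ ∪ Set.range e₂ = Set.univ ∧ Set.range e₁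 ∩ Set.range e₂ = e₁ '' (𝓡∂ 4).boundary W₁ ∧ Set.range e₁ ∩ Set.range e₂ = e₂ '' (𝓡∂ 4).boundary W₂ ∧ (∀ w₁ w₂, e₁ w₁ = e₂ w₂ → Submodule.map (mfderiv (𝓡∂ 4) (𝓡 4) e₁ w₁).toLinearMap (Literature.Geometry.Symplectic.contactPlane J₁.J w₁) = Submodule.map (mfderiv (𝓡∂ 4) (𝓡 4) e₂ w₂).toLinearMap (Literature.Geometry.Symplectic.contactPlane J₂.J w₂)) ∧ (∀ k, 0 < k → CategoryTheory.Limits.IsZero (Literature.AlgebraicTopology.SingularHomology.singularHomology ℚ ℚ W₁ k) ∧ CategoryTheory.Limits.IsZero (Literature.AlgebraicTopology.SingularHomology.singularHomology ℚ ℚ W₂ k)) ∧ Literature.Geometry.Symplectic.PlanarContactBoundary J₁) → Nonempty (M ≃ₘ⟮𝓡 4, 𝓡 4⟯ Metric.sphere (0 : EuclideanSpace ℝ (Fin 5)) 1)) →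
    (∀ (X : Type) [TopologicalSpace X] [T2Space X] [SecondCountableTopology X] [CompactSpace X] [ChartedSpace (EuclideanSpace ℝ (Fin 4)) X] [IsManifold (𝓡 4) ∞ X] (W₁ : Type) [TopologicalSpace W₁] [ChartedSpace (EuclideanHalfSpace 4) W₁] [IsManifold (𝓡∂ 4) ∞ W₁] [CompactSpace W₁] [ContractibleSpace W₁] (W₂ : Type) [TopologicalSpace W₂] [ChartedSpace (EuclideanHalfSpace 4) W₂] [IsManifold (𝓡∂ 4) ∞ W₂] [CompactSpace W₂] [ContractibleSpace W₂] (J₁ : Literature.Geometry.Symplectic.SteinStructure W₁) (J₂ : Literature.Geometry.Symplectic.SteinStructure W₂) (e₁ : W₁ → X) (e₂ : W₂ → X), Manifold.IsSmoothEmbedding (𝓡∂ 4) (𝓡 4) ∞ e₁ → Manifold.IsSmoothEmbedding (𝓡∂ 4) (𝓡 4) ∞ e₂ → Set.range e₁ ∪ Set.range e₂ = Set.univ → Set.range e₁ ∩ Set.range e₂ = e₁ '' (𝓡∂ 4).boundary W₁ → Set.range e₁ ∩ Set.range e₂ = e₂ '' (𝓡∂ 4).boundary W₂ → (∀ w₁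 w₂, e₁ w₁ = e₂ w₂ → Submodule.map (mfderiv (𝓡∂ 4) (𝓡 4) e₁ w₁).toLinearMap (Literature.Geometry.Symplectic.contactPlane J₁.J w₁) = Submodule.map (mfderiv (𝓡∂ 4) (𝓡 4) e₂ w₂).toLinearMap (Literature.Geometry.Symplectic.contactPlane J₂.J w₂)) → Nonempty (X ≃ₘ⟮𝓡 4, 𝓡 4⟯ Metric.sphere (0 : EuclideanSpace ℝ (Fin 5)) 1)) →
    (∀ (M : Type) [TopologicalSpace M] [T2Space M] [SecondCountableTopology M] [ChartedSpace (EuclideanSpace ℝ (Fin 4)) M] [IsManifold (𝓡 4) ∞ M], M ≃ₕ Metric.sphere (0 : EuclideanSpace ℝ (Fin 5)) 1 → (∃ (W₁ : Type) (_ : TopologicalSpace W₁) (_ : ChartedSpace (EuclideanHalfSpace 4) W₁) (_ : IsManifold (𝓡∂ 4) ∞ W₁) (_ : CompactSpace W₁) (W₂ : Type) (_ : TopologicalSpace W₂) (_ : ChartedSpace (EuclideanHalfSpace 4) W₂) (_ : IsManifold (𝓡∂ 4) ∞ W₂) (_ : CompactSpace W₂) (J₁ : Literature.Geometry.Symplectic.SteinStructure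 W₁) (J₂ : Literature.Geometry.Symplectic.SteinStructure W₂) (e₁ : W₁ → M) (e₂ : W₂ → M), Manifold.IsSmoothEmbedding (𝓡∂ 4) (𝓡 4) ∞ e₁ ∧ Manifold.IsSmoothEmbedding (𝓡∂ 4) (𝓡 4) ∞ e₂ ∧ Set.range e₁ ∪ Set.range e₂ = Set.univ ∧ Set.range e₁ ∩ Set.range e₂ = e₁ '' (𝓡∂ 4).boundary W₁ ∧ Set.range e₁ ∩ Set.range e₂ = e₂ '' (𝓡∂ 4).boundary W₂ ∧ (∀ w₁ w₂, e₁ w₁ = e₂ w₂ → Submodule.map (mfderiv (𝓡∂ 4) (𝓡 4) e₁ w₁).toLinearMap (Literature.Geometry.Symplectic.contactPlane J₁.J w₁) = Submodule.map (mfderiv (𝓡∂ 4) (𝓡 4) e₂ w₂).toLinearMap (Literature.Geometry.Symplectic.contactPlane J₂.J w₂)) ∧ (∀ k, 0 < k → CategoryTheory.Limits.IsZero (Literature.AlgebraicTopology.SingularHomology.singularHomology ℚ ℚ W₁ k) ∧ CategoryTheory.Limits.IsZero (Literature.AlgebraicTopology.SingularHomology.singularHomology ℚ ℚ W₂ k))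 ∧ ¬ Literature.Geometry.Symplectic.PlanarContactBoundary J₁ ∧ ¬ (ContractibleSpace W₁ ∧ ContractibleSpace W₂)) → Nonempty (M ≃ₘ⟮𝓡 4, 𝓡 4⟯ Metric.sphere (0 : EuclideanSpace ℝ (Fin 5)) 1)) →
    (∀ (M : Type) [TopologicalSpace M] [T2Space M] [SecondCountableTopology M] [ChartedSpace (EuclideanSpace ℝ (Fin 4)) M] [IsManifold (𝓡 4) ∞ M], M ≃ₕ Metric.sphere (0 : EuclideanSpace ℝ (Fin 5)) 1 → (∃ (W₁ : Type) (_ : TopologicalSpace W₁) (_ : ChartedSpace (EuclideanHalfSpace 4) W₁) (_ : IsManifold (𝓡∂ 4) ∞ W₁) (_ : CompactSpace W₁) (W₂ : Type) (_ : TopologicalSpace W₂) (_ : ChartedSpace (EuclideanHalfSpace 4) W₂) (_ : IsManifold (𝓡∂ 4) ∞ W₂) (_ : CompactSpace W₂) (J₁ : Literature.Geometry.Symplectic.SteinStructure W₁) (J₂ : Literature.Geometry.Symplectic.SteinStructure W₂) (e₁ : W₁ → M) (e₂ : W₂ → M), Manifold.IsSmoothEmbedding (𝓡∂ 4) (𝓡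 4) ∞ e₁ ∧ Manifold.IsSmoothEmbedding (𝓡∂ 4) (𝓡 4) ∞ e₂ ∧ Set.range e₁ ∪ Set.range e₂ = Set.univ ∧ Set.range e₁ ∩ Set.range e₂ = e₁ '' (𝓡∂ 4).boundary W₁ ∧ Set.range e₁ ∩ Set.range e₂ = e₂ '' (𝓡∂ 4).boundary W₂ ∧ (∀ w₁ w₂, e₁ w₁ = e₂ w₂ → Submodule.map (mfderiv (𝓡∂ 4) (𝓡 4) e₁ w₁).toLinearMap (Literature.Geometry.Symplectic.contactPlane J₁.J w₁) = Submodule.map (mfderiv (𝓡∂ 4) (𝓡 4) e₂ w₂).toLinearMap (Literature.Geometry.Symplectic.contactPlane J₂.J w₂)) ∧ (∀ k, 0 < k → CategoryTheory.Limits.IsZero (Literature.AlgebraicTopology.SingularHomology.singularHomology ℚ ℚ W₁ k) ∧ CategoryTheory.Limits.IsZero (Literature.AlgebraicTopology.SingularHomology.singularHomology ℚ ℚ W₂ k))) → Nonempty (M ≃ₘ⟮𝓡 4, 𝓡 4⟯ Metric.sphere (0 : EuclideanSpace ℝ (Fin 5)) 1)) := by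
  intro hP hC hS M _ _ _ _ _ e hb
  obtain ⟨W₁, _, _, _, _, W₂, _, _, _, _, J₁, J₂, e₁, e₂, h₁, h₂, hcov, hs₁, hs₂, hξ, hacyc⟩ := hb
  by_cases hp : Literature.Geometry.Symplectic.PlanarContactBoundary J₁
  · exact hP M e
      ⟨W₁, _, _, _, _, W₂, _, _, _, _, J₁, J₂, e₁, e₂, h₁, h₂, hcov, hs₁, hs₂, hξ, hacyc, hp⟩
  by_cases hc : ContractibleSpace W₁ ∧ ContractibleSpace W₂
  · obtain ⟨hc₁, hc₂⟩ := hc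
    -- `M = e₁(W₁) ∪ e₂(W₂)` is compact as the union of two compact images
    haveI : CompactSpace M := isCompact_univ_iff.mp (hcov ▸
      ((isCompact_range h₁.isEmbedding.continuous).union
        (isCompact_range h₂.isEmbedding.continuous)))
    exact hC M W₁ W₂ J₁ J₂ e₁ e₂ h₁ h₂ hcov hs₁ hs₂ hξ
  · exact hS M e
      ⟨W₁, _, _, _, _, W₂, _, _, _, _, J₁, J₂, e₁, e₂, h₁, h₂, hcov, hs₁, hs₂, hξ, hacyc, hp, hc⟩

end Summit.SmoothPoincare4.SmoothPoincare4.Theorems
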